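import Mathlib.MeasureTheory.Constructions.HaarToSphere
import Mathlib.MeasureTheory.Measure.Lebesgue.VolumeOfBalls
import Mathlib.MeasureTheory.Measure.Haar.InnerProductSpace
import Mathlib.Analysis.SpecialFunctions.Integrals.Basic
import Mathlib.Analysis.SpecialFunctions.Gamma.Basic
import Mathlib.Analysis.SpecialFunctions.Trigonometric.Bounds
import Literature.Barriers.CriticalPhenomena.WeaklySAWFourDimLogCorrectionsReduction
import HarnessLib

/-!
# `WeaklySAWFourDimLogCorrections` (BBS 2015): the free bubble asymptotics (1.8) at `d = 4`,
# proved — `𝖡_{m²} ∼ 𝖻 log m⁻²`, `𝖻 = 1/(2π²)`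

Companion to `WeaklySAWFourDimLogCorrectionsReduction.lean` (Bauerschmidt–Brydges–Slade, CMP 337
(2015), arXiv:1403.7422), whose reduction of Theorem 1.1 consumes the named fact
`CTWSAW.BBS2015_eq18`: as `m² ↓ 0`,
`𝖡_{m²} = 8∫_{[-π,π]⁴} |1/(4Σⱼ sin²(kⱼ/2) + m²)|² dk/(2π)⁴ ∼ 𝖻 log m⁻²`, "by Parseval's formula and
elementary calculus". This file DISCHARGES it (`BBS2015_eq18_holds`) by the elementary calculus:

* the symbol `D(k) = 4Σ sin²(kⱼ/2)` satisfies `D ≤ |k|²` (`sin² x ≤ x²`), `D ≥ (1 - ρ²/12)|k|²` on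
  the Euclidean ball `|k| ≤ ρ ≤ 1` (`sin y ≥ y - y³/6`), and `D ≥ ρ²/π²` on `[-π,π]⁴ ∖ {|k| < ρ}`
  (Jordan's inequality, the tree's `mul_norm_sq_le_dispersion`);
* polar coordinates in `ℝ⁴` (Mathlib's `integral_fun_norm_addHaar`, transferred from `Fin 4 → ℝ`
  to `EuclideanSpace ℝ (Fin 4)` by the volume-preserving `WithLp.toLp`; `|B₁| = π²/2`):
  `∫_{|k|<ρ} dk/(|k|² + μ)² = 2π²∫₀^ρ r³/(r² + μ)² dr = π²(log((ρ² + μ)/μ) + μ/(ρ² + μ) - 1)`;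
* hence `π²(log((π² + m²)/m²) + … ) ≤ ∫_{[-π,π]⁴} dk/(D + m²)² ≤ c_ρ⁻²π²(log((ρ² + m²/c_ρ)c_ρ/m²) + …)
  + 16π⁸/ρ⁴` with `c_ρ = 1 - ρ²/12`, and both bounds divided by `π² log m⁻²` tend to `1`
  resp. `c_ρ⁻²`; letting `ρ ↓ 0` gives the claim (`8/(2π)⁴ · π² = 1/(2π²) = 𝖻`).

Contents (namespace `Literature.Barriers.CriticalPhenomena.CTWSAW`): `nsq`, `symb`, `eBall`
(auxiliary), the pointwise bounds, `integral_eBall_radial` (polar coordinates),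
`integral_eBall_inv_sq` (the explicit radial integral), `bubbleIntegral_ge`, `bubbleIntegral_le`,
`BBS2015_eq18_holds`.
-/

noncomputable section

open MeasureTheory Filter Topology Set Metric
open Literature.Probability.LatticeModels
open scoped Real ENNReal BigOperators

namespace Literature.Barriers.CriticalPhenomena

namespace CTWSAW

/-! ### The symbol `D(k) = 4Σ sin²(kⱼ/2)` against `|k|²` -/

/-- `|k|² = Σⱼ kⱼ²` (Euclidean norm squared on `ℝ⁴`, written on `Fin 4 → ℝ`). [folklore] -/
def nsq (k : Fin 4 → ℝ) : ℝ := ∑ j, k j ^ 2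

/-- The symbol `D(k) = 4Σⱼ sin²(kⱼ/2)` of `-Δ` on `ℤ⁴` (the denominator of (1.8) at `m² = 0`).
[cite: BauerschmidtBrydgesSlade2015LogCorr, eq. (1.8)] -/
def symb (k : Fin 4 → ℝ) : ℝ := 4 * ∑ j, Real.sin (k j / 2) ^ 2

/-- The Euclidean ball `{|k| < ρ}` in `Fin 4 → ℝ`. [folklore] -/
def eBall (ρ : ℝ) : Set (Fin 4 → ℝ) := {k | nsq k < ρ ^ 2}

/-- `|k|² ≥ 0`. [folklore] -/
theorem nsq_nonneg (k : Fin 4 → ℝ) : 0 ≤ nsq k := Finset.sum_nonneg fun _ _ => sq_nonneg _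

/-- `D(k) ≥ 0`. [folklore] -/
theorem symb_nonneg (k : Fin 4 → ℝ) : 0 ≤ symb k :=
  mul_nonneg (by norm_num) (Finset.sum_nonneg fun _ _ => sq_nonneg _)

/-- `kⱼ² ≤ |k|²`. [folklore] -/
theorem sq_le_nsq (k : Fin 4 → ℝ) (j : Fin 4) : k j ^ 2 ≤ nsq k :=
  Finset.single_le_sum (f := fun j => k j ^ 2) (fun _ _ => sq_nonneg _) (Finset.mem_univ j)

/-- `|k|²` is continuous. [folklore] -/
theorem continuous_nsq : Continuous nsq := by unfold nsq; fun_prop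

/-- `D` is continuous. [folklore] -/
theorem continuous_symb : Continuous symb := by unfold symb; fun_prop

/-- Euclidean balls are measurable. [folklore] -/
theorem measurableSet_eBall (ρ : ℝ) : MeasurableSet (eBall ρ) :=
  measurableSet_lt continuous_nsq.measurable measurable_const

/-- `D(k) ≤ |k|²` (`sin² x ≤ x²`). [folklore] -/
theorem symb_le_nsq (k : Fin 4 → ℝ) : symb k ≤ nsq k := by
  unfold symb nsq
  rw [Finset.mul_sum]
  refine Finset.sum_le_sum fun j _ => ?_
  have := Real.sin_sq_le_sq (x := k j / 2)
  nlinarith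

/-- One coordinate of the lower bound: `(1 - ρ²/12)x² ≤ 4 sin²(x/2)` for `|x| ≤ ρ ≤ 1`
(`sin y ≥ y - y³/6` for `y ≥ 0`). [folklore] -/
theorem mul_sq_le_four_sin_sq {ρ x : ℝ} (hρ0 : 0 ≤ ρ) (hρ1 : ρ ≤ 1) (hx : x ^ 2 ≤ ρ ^ 2) :
    (1 - ρ ^ 2 / 12) * x ^ 2 ≤ 4 * Real.sin (x / 2) ^ 2 := by
  -- reduce to `y = |x|/2 ∈ [0, 1/2]`
  have heven : Real.sin (x / 2) ^ 2 = Real.sin (|x| / 2) ^ 2 := by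
    rcases le_total 0 x with h | h
    · rw [abs_of_nonneg h]
    · rw [abs_of_nonpos h, neg_div, Real.sin_neg, neg_sq]
  rw [heven]
  set y : ℝ := |x| / 2 with hy
  have hy0 : 0 ≤ y := by positivity
  have hx2 : x ^ 2 = 4 * y ^ 2 := by rw [hy, div_pow, sq_abs]; ring
  have hyρ : y ^ 2 ≤ ρ ^ 2 / 4 := by nlinarith
  have hρsq : ρ ^ 2 ≤ 1 := by nlinarith
  have hy1 : y ^ 2 ≤ 1 / 4 := by nlinarith
  rcases hy0.eq_or_lt with h0 | hpos
  · rw [hx2, ← h0]; simp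
  have hsin : y - y ^ 3 / 6 ≤ Real.sin y := (Real.sin_gt_sub_cube hpos).le
  have hlow : 0 ≤ y - y ^ 3 / 6 := by nlinarith
  have hsq : (y - y ^ 3 / 6) ^ 2 ≤ Real.sin y ^ 2 := pow_le_pow_left₀ hlow hsin 2
  rw [hx2]
  nlinarith [sq_nonneg y, mul_nonneg (sq_nonneg y) (sq_nonneg y)]

/-- `D(k) ≥ (1 - ρ²/12)|k|²` on `|k| ≤ ρ ≤ 1`. [folklore] -/
theorem mul_nsq_le_symb {ρ : ℝ} (hρ0 : 0 ≤ ρ) (hρ1 : ρ ≤ 1) {k : Fin 4 → ℝ} (hk : nsq k ≤ ρ ^ 2) :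
    (1 - ρ ^ 2 / 12) * nsq k ≤ symb k := by
  unfold symb
  rw [nsq, Finset.mul_sum, Finset.mul_sum]
  exact Finset.sum_le_sum fun j _ => mul_sq_le_four_sin_sq hρ0 hρ1 ((sq_le_nsq k j).trans hk)

/-- `D(k) ≥ ρ²/π²` on `[-π,π]⁴ ∖ {|k| < ρ}` (Jordan's inequality). [folklore] -/
theorem symb_ge_of_le_nsq {ρ : ℝ} {k : Fin 4 → ℝ} (hk : k ∈ brillouin 4) (hρk : ρ ^ 2 ≤ nsq k) :
    ρ ^ 2 / π ^ 2 ≤ symb k := by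
  have h1 : symb k = 2 * dispersion k := four_mul_sum_sin_sq_half k
  have h2 := mul_norm_sq_le_dispersion hk
  have h3 : nsq k ≤ 4 * ‖k‖ ^ 2 := by
    calc nsq k = ∑ j, k j ^ 2 := rfl
      _ ≤ ∑ _j : Fin 4, ‖k‖ ^ 2 := Finset.sum_le_sum fun j _ => by
          rw [← sq_abs, ← Real.norm_eq_abs]
          exact pow_le_pow_left₀ (norm_nonneg _) (norm_le_pi_norm k j) 2
      _ = 4 * ‖k‖ ^ 2 := by simp
  have hπ : (0 : ℝ) < π ^ 2 := by positivity
  have h4 : 2 * ‖k‖ ^ 2 ≤ dispersion k * π ^ 2 := by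
    rw [div_mul_eq_mul_div, div_le_iff₀ hπ] at h2
    linarith
  rw [h1, div_le_iff₀ hπ]
  nlinarith [h4, hρk, h3]

/-- The Euclidean ball of radius `π` lies in the Brillouin zone `[-π,π]⁴`. [folklore] -/
theorem eBall_subset_brillouin {ρ : ℝ} (hρ0 : 0 ≤ ρ) (hρ : ρ ≤ π) : eBall ρ ⊆ brillouin 4 := by
  intro k hk i _
  have h1 : k i ^ 2 < ρ ^ 2 := (sq_le_nsq k i).trans_lt hk
  have h2 : |k i| < |ρ| := sq_lt_sq.1 h1
  rw [abs_of_nonneg hρ0] at h2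
  have h3 := abs_lt.1 (h2.trans_le hρ)
  exact ⟨h3.1.le, h3.2.le⟩

/-! ### Integrability on the Brillouin zone -/

/-- `k ↦ 1/(D(k) + m²)²` is integrable on `[-π,π]⁴` for `m² > 0` (continuous on a compact set).
[folklore] -/
theorem integrableOn_inv_symb_sq {m : ℝ} (hm : 0 < m) (s : Set (Fin 4 → ℝ)) (hs : s ⊆ brillouin 4) :
    IntegrableOn (fun k => 1 / (symb k + m) ^ 2) s := by
  have hc : Continuous fun k => 1 / (symb k + m) ^ 2 := by
    refine Continuous.div continuous_const ((continuous_symb.add continuous_const).pow 2) fun k => ?_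
    have := symb_nonneg k
    positivity
  exact (hc.continuousOn.integrableOn_compact (isCompact_brillouin 4)).mono_set hs

/-- `k ↦ 1/(c|k|² + μ)²` is integrable on subsets of `[-π,π]⁴` for `c ≥ 0`, `μ > 0`. [folklore] -/
theorem integrableOn_inv_nsq_sq {c μ : ℝ} (hc : 0 ≤ c) (hμ : 0 < μ) (s : Set (Fin 4 → ℝ))
    (hs : s ⊆ brillouin 4) : IntegrableOn (fun k => 1 / (c * nsq k + μ) ^ 2) s := by
  have hcont : Continuous fun k => 1 / (c * nsq k + μ) ^ 2 := by
    refine Continuous.div continuous_const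
      (((continuous_const.mul continuous_nsq).add continuous_const).pow 2) fun k => ?_
    have := mul_nonneg hc (nsq_nonneg k)
    positivity
  exact (hcont.continuousOn.integrableOn_compact (isCompact_brillouin 4)).mono_set hs

/-- `|[-π,π]⁴| = (2π)⁴`. [folklore] -/
theorem volume_real_brillouin_four : (volume (brillouin 4)).toReal = (2 * π) ^ 4 := by
  rw [brillouin, volume_pi_pi]
  simp only [Real.volume_Icc, Finset.prod_const, Finset.card_univ, Fintype.card_fin]
  rw [ENNReal.toReal_pow, ENNReal.toReal_ofReal (by linarith [Real.pi_pos])]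
  ring

/-! ### Polar coordinates: `∫_{|k|<ρ} h(|k|) dk = 2π² ∫₀^ρ r³ h(r) dr` -/

/-- `|B(0,1)| = π²/2` in `ℝ⁴`. [folklore] -/
theorem volume_real_ball_euclidean_four :
    (volume (ball (0 : EuclideanSpace ℝ (Fin 4)) 1)).toReal = π ^ 2 / 2 := by
  rw [EuclideanSpace.volume_ball]
  simp only [Fintype.card_fin, ENNReal.ofReal_one, one_pow, one_mul]
  have hG : Real.Gamma ((4 : ℕ) / 2 + 1) = 2 := by
    rw [show ((4 : ℕ) : ℝ) / 2 + 1 = (2 : ℕ) + 1 by norm_num, Real.Gamma_nat_eq_factorial]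
    norm_num
  rw [hG, ENNReal.toReal_ofReal (by positivity)]
  rw [show Real.sqrt π ^ 4 = (Real.sqrt π ^ 2) ^ 2 by ring, Real.sq_sqrt Real.pi_pos.le]

/-- Polar coordinates for radial functions on balls of `ℝ⁴` (Mathlib's
`integral_fun_norm_addHaar`). [folklore] -/
theorem integral_ball_radial_four (h : ℝ → ℝ) (ρ : ℝ) :
    ∫ x in ball (0 : EuclideanSpace ℝ (Fin 4)) ρ, h ‖x‖ =
      2 * π ^ 2 * ∫ y in Ioo 0 ρ, y ^ 3 * h y := by
  have h1 : ∫ x in ball (0 : EuclideanSpace ℝ (Fin 4)) ρ, h ‖x‖ =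
      ∫ x : EuclideanSpace ℝ (Fin 4), (Iio ρ).indicator h ‖x‖ := by
    rw [← integral_indicator measurableSet_ball]
    congr 1
    funext x
    simp only [indicator, mem_ball, dist_zero_right, mem_Iio]
  rw [h1, integral_fun_norm_addHaar volume ((Iio ρ).indicator h)]
  simp only [finrank_euclideanSpace, Fintype.card_fin, Measure.real,
    volume_real_ball_euclidean_four, smul_eq_mul]
  have h2 : ∫ y in Ioi (0 : ℝ), y ^ (4 - 1) * (Iio ρ).indicator h y =
      ∫ y in Ioo (0 : ℝ) ρ, y ^ 3 * h y := by
    have : (fun y : ℝ => y ^ (4 - 1) * (Iio ρ).indicator h y) =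
        (Iio ρ).indicator (fun y => y ^ 3 * h y) := by
      funext y
      simp only [indicator, mem_Iio]
      split_ifs <;> simp
    rw [this, setIntegral_indicator measurableSet_Iio, Ioi_inter_Iio]
  rw [h2]
  ring

/-- Transfer to the coordinate space: for `ρ > 0`,
`∫_{eBall ρ} h(√(Σkⱼ²)) dk = ∫_{B(0,ρ)} h(‖x‖) dx` (the volume-preserving `WithLp.toLp`).
[folklore] -/
theorem integral_eBall_eq_integral_ball {ρ : ℝ} (hρ : 0 < ρ) (h : ℝ → ℝ) :
    ∫ k in eBall ρ, h (Real.sqrt (nsq k)) = ∫ x in ball (0 : EuclideanSpace ℝ (Fin 4)) ρ, h ‖x‖ := by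
  have hT := PiLp.volume_preserving_toLp (Fin 4)
  have hnorm : ∀ k : Fin 4 → ℝ, ‖(WithLp.toLp 2 k : EuclideanSpace ℝ (Fin 4))‖ = Real.sqrt (nsq k) := by
    intro k
    rw [EuclideanSpace.norm_eq, nsq]
    congr 1
    refine Finset.sum_congr rfl fun j _ => ?_
    simp [Real.norm_eq_abs, sq_abs]
  have hset : eBall ρ = (WithLp.toLp 2) ⁻¹' ball (0 : EuclideanSpace ℝ (Fin 4)) ρ := by
    ext k
    simp only [eBall, mem_setOf_eq, mem_preimage, mem_ball, dist_zero_right, hnorm]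
    constructor
    · intro h1
      calc Real.sqrt (nsq k) < Real.sqrt (ρ ^ 2) := Real.sqrt_lt_sqrt (nsq_nonneg k) h1
        _ = ρ := Real.sqrt_sq hρ.le
    · intro hlt
      exact (Real.sqrt_lt' hρ).1 hlt
  rw [hset, ← hT.setIntegral_preimage_emb (MeasurableEquiv.toLp 2 (Fin 4 → ℝ)).measurableEmbedding]
  refine setIntegral_congr_fun
    (measurableSet_ball.preimage (MeasurableEquiv.toLp 2 (Fin 4 → ℝ)).measurable) fun x _ => ?_
  simp only [hnorm]

/-- The explicit radial integral: for `ρ ≥ 0`, `μ > 0`,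
`∫₀^ρ y³/(y² + μ)² dy = ½(log((ρ² + μ)/μ) + μ/(ρ² + μ) - 1)` (the primitive is
`½(log(y² + μ) + μ/(y² + μ))`). [folklore] -/
theorem integral_cube_div_sq {ρ μ : ℝ} (hρ : 0 ≤ ρ) (hμ : 0 < μ) :
    ∫ y in Ioo 0 ρ, y ^ 3 * (1 / (y ^ 2 + μ) ^ 2) =
      1 / 2 * (Real.log ((ρ ^ 2 + μ) / μ) + μ / (ρ ^ 2 + μ) - 1) := by
  set Φ : ℝ → ℝ := fun y => 1 / 2 * (Real.log (y ^ 2 + μ) + μ * (y ^ 2 + μ)⁻¹) with hΦ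
  have hpos : ∀ y : ℝ, 0 < y ^ 2 + μ := fun y => by positivity
  have hderiv : ∀ y : ℝ, HasDerivAt Φ (y ^ 3 * (1 / (y ^ 2 + μ) ^ 2)) y := by
    intro y
    have h1 : HasDerivAt (fun y : ℝ => y ^ 2 + μ) (2 * y) y := by
      simpa using (hasDerivAt_pow 2 y).add_const μ
    have h2 : HasDerivAt (fun y : ℝ => Real.log (y ^ 2 + μ)) (2 * y / (y ^ 2 + μ)) y :=
      h1.log (hpos y).ne'
    have h3 : HasDerivAt (fun y : ℝ => μ * (y ^ 2 + μ)⁻¹) (μ * (-(2 * y) / (y ^ 2 + μ) ^ 2)) y :=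
      (h1.inv (hpos y).ne').const_mul μ
    have h4 := (h2.add h3).const_mul (1 / 2 : ℝ)
    refine h4.congr_deriv ?_
    field_simp
    ring
  rw [← integral_Ioc_eq_integral_Ioo, ← intervalIntegral.integral_of_le hρ,
    intervalIntegral.integral_eq_sub_of_hasDerivAt (fun y _ => hderiv y)
      (((continuous_pow 3).mul (continuous_const.div
        (((continuous_pow 2).add continuous_const).pow 2)
        fun y => (pow_pos (hpos y) 2).ne')).intervalIntegrable _ _)]
  simp only [hΦ]
  rw [Real.log_div (hpos ρ).ne' hμ.ne']
  simp only [ne_eq, OfNat.ofNat_ne_zero, not_false_eq_true, zero_pow, zero_add]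
  field_simp
  ring

/-- **Polar evaluation**: for `ρ > 0`, `μ > 0`,
`∫_{|k|<ρ} dk/(|k|² + μ)² = π²(log((ρ² + μ)/μ) + μ/(ρ² + μ) - 1)`. [folklore] -/
theorem integral_eBall_inv_sq {ρ μ : ℝ} (hρ : 0 < ρ) (hμ : 0 < μ) :
    ∫ k in eBall ρ, 1 / (nsq k + μ) ^ 2 =
      π ^ 2 * (Real.log ((ρ ^ 2 + μ) / μ) + μ / (ρ ^ 2 + μ) - 1) := by
  have h1 : ∫ k in eBall ρ, 1 / (nsq k + μ) ^ 2 =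
      ∫ k in eBall ρ, (fun r => 1 / (r ^ 2 + μ) ^ 2) (Real.sqrt (nsq k)) := by
    refine setIntegral_congr_fun (measurableSet_eBall ρ) fun k _ => ?_
    simp only [Real.sq_sqrt (nsq_nonneg k)]
  rw [h1, integral_eBall_eq_integral_ball hρ (fun r => 1 / (r ^ 2 + μ) ^ 2),
    integral_ball_radial_four (fun r => 1 / (r ^ 2 + μ) ^ 2) ρ, integral_cube_div_sq hρ.le hμ]
  ring

/-! ### The two-sided bound on `∫_{[-π,π]⁴} dk/(D(k) + m²)²` -/

/-- Lower bound: `∫_{[-π,π]⁴} dk/(D + m²)² ≥ ∫_{|k|<π} dk/(|k|² + m²)²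
= π²(log((π² + m²)/m²) + m²/(π² + m²) - 1)`. [folklore] -/
theorem bubbleIntegral_ge {m : ℝ} (hm : 0 < m) :
    π ^ 2 * (Real.log ((π ^ 2 + m) / m) + m / (π ^ 2 + m) - 1) ≤
      ∫ k in brillouin 4, 1 / (symb k + m) ^ 2 := by
  rw [← integral_eBall_inv_sq Real.pi_pos hm]
  have hsub : eBall π ⊆ brillouin 4 := eBall_subset_brillouin Real.pi_pos.le le_rfl
  calc ∫ k in eBall π, 1 / (nsq k + m) ^ 2 ≤ ∫ k in eBall π, 1 / (symb k + m) ^ 2 := by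
        refine setIntegral_mono_on ?_ (integrableOn_inv_symb_sq hm _ hsub) (measurableSet_eBall π)
          fun k _ => ?_
        · have := integrableOn_inv_nsq_sq zero_le_one hm _ hsub
          simpa using this
        · have h1 := symb_le_nsq k
          have h2 := symb_nonneg k
          exact one_div_le_one_div_of_le (by positivity) (by nlinarith)
    _ ≤ ∫ k in brillouin 4, 1 / (symb k + m) ^ 2 :=
        setIntegral_mono_set (integrableOn_inv_symb_sq hm _ le_rfl)
          (Eventually.of_forall fun k => by have := symb_nonneg k; positivity)
          (Eventually.of_forall hsub)

/-- Upper bound: for `0 < ρ ≤ 1`, with `c = 1 - ρ²/12`,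
`∫_{[-π,π]⁴} dk/(D + m²)² ≤ c⁻² π²(log((ρ² + m²/c)/(m²/c)) + (m²/c)/(ρ² + m²/c) - 1) + 16π⁸/ρ⁴`.
[folklore] -/
theorem bubbleIntegral_le {m ρ : ℝ} (hm : 0 < m) (hρ : 0 < ρ) (hρ1 : ρ ≤ 1) :
    ∫ k in brillouin 4, 1 / (symb k + m) ^ 2 ≤
      (1 - ρ ^ 2 / 12)⁻¹ ^ 2 * (π ^ 2 * (Real.log ((ρ ^ 2 + m / (1 - ρ ^ 2 / 12)) /
        (m / (1 - ρ ^ 2 / 12))) + (m / (1 - ρ ^ 2 / 12)) / (ρ ^ 2 + m / (1 - ρ ^ 2 / 12)) - 1)) +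
      (π ^ 2 / ρ ^ 2) ^ 2 * (2 * π) ^ 4 := by
  set c : ℝ := 1 - ρ ^ 2 / 12 with hc
  have hcpos : 0 < c := by rw [hc]; nlinarith
  have hρπ : ρ ≤ π := hρ1.trans (by linarith [Real.two_le_pi])
  have hsub : eBall ρ ⊆ brillouin 4 := eBall_subset_brillouin hρ.le hρπ
  have hf := integrableOn_inv_symb_sq hm _ (le_refl (brillouin 4))
  -- split the Brillouin zone at `|k| = ρ`
  have hsplit := integral_inter_add_sdiff (μ := volume) (f := fun k => 1 / (symb k + m) ^ 2)
    (measurableSet_eBall ρ) hf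
  rw [inter_eq_right.2 hsub] at hsplit
  rw [← hsplit]
  gcongr
  · -- inside the ball: `D ≥ c|k|²`
    calc ∫ k in eBall ρ, 1 / (symb k + m) ^ 2 ≤ ∫ k in eBall ρ, 1 / (c * nsq k + m) ^ 2 := by
          refine setIntegral_mono_on (hf.mono_set hsub) (integrableOn_inv_nsq_sq hcpos.le hm _ hsub)
            (measurableSet_eBall ρ) fun k hk => ?_
          have h1 : c * nsq k ≤ symb k := mul_nsq_le_symb hρ.le hρ1 (le_of_lt hk)
          have h2 := mul_nonneg hcpos.le (nsq_nonneg k)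
          exact one_div_le_one_div_of_le (by positivity)
            (pow_le_pow_left₀ (by positivity) (by linarith) 2)
      _ = c⁻¹ ^ 2 * ∫ k in eBall ρ, 1 / (nsq k + m / c) ^ 2 := by
          rw [← integral_const_mul]
          refine setIntegral_congr_fun (measurableSet_eBall ρ) fun k _ => ?_
          have : c * nsq k + m = c * (nsq k + m / c) := by field_simp
          rw [this]
          field_simp
      _ = c⁻¹ ^ 2 * (π ^ 2 * (Real.log ((ρ ^ 2 + m / c) / (m / c)) +
            (m / c) / (ρ ^ 2 + m / c) - 1)) := by
          rw [integral_eBall_inv_sq hρ (div_pos hm hcpos)]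
  · -- outside the ball: `D ≥ ρ²/π²`
    have hconst : IntegrableOn (fun _ : Fin 4 → ℝ => (π ^ 2 / ρ ^ 2) ^ 2) (brillouin 4 \ eBall ρ) :=
      (integrableOn_const_iff (C := (π ^ 2 / ρ ^ 2) ^ 2)).2
        (Or.inr ((measure_mono sdiff_subset).trans_lt
          (isCompact_brillouin 4).measure_lt_top))
    calc ∫ k in brillouin 4 \ eBall ρ, 1 / (symb k + m) ^ 2
        ≤ ∫ _ in brillouin 4 \ eBall ρ, (π ^ 2 / ρ ^ 2) ^ 2 := by
          refine setIntegral_mono_on (hf.mono_set sdiff_subset) hconst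
            ((measurableSet_brillouin 4).diff (measurableSet_eBall ρ)) fun k hk => ?_
          have h1 : ρ ^ 2 / π ^ 2 ≤ symb k := symb_ge_of_le_nsq hk.1 (not_lt.1 hk.2)
          have h2 : 0 < ρ ^ 2 / π ^ 2 := by positivity
          calc 1 / (symb k + m) ^ 2 ≤ 1 / (ρ ^ 2 / π ^ 2) ^ 2 :=
                one_div_le_one_div_of_le (by positivity) (by
                  apply pow_le_pow_left₀ h2.le; linarith)
            _ = (π ^ 2 / ρ ^ 2) ^ 2 := by field_simp
      _ = (volume (brillouin 4 \ eBall ρ)).toReal * (π ^ 2 / ρ ^ 2) ^ 2 := by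
          rw [setIntegral_const, smul_eq_mul, Measure.real]
      _ ≤ (volume (brillouin 4)).toReal * (π ^ 2 / ρ ^ 2) ^ 2 := by
          gcongr
          · exact (isCompact_brillouin 4).measure_lt_top.ne
          · exact sdiff_subset
      _ = (π ^ 2 / ρ ^ 2) ^ 2 * (2 * π) ^ 4 := by rw [volume_real_brillouin_four]; ring

/-! ### The limit `m² ↓ 0` -/

/-- `𝖡_{m²} = 8 J(m²)/(2π)⁴` with `J(m²) = ∫_{[-π,π]⁴} dk/(D(k) + m²)²` (the integrand of (1.8)
without the absolute value). [cite: BauerschmidtBrydgesSlade2015LogCorr, eq. (1.8)] -/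
theorem freeBubble_four_eq (m : ℝ) :
    freeBubble 4 m = 8 * (∫ k in brillouin 4, 1 / (symb k + m) ^ 2) / (2 * π) ^ 4 := by
  unfold freeBubble
  rw [mul_div_assoc]
  congr 2
  refine setIntegral_congr_fun (measurableSet_brillouin 4) fun k _ => ?_
  show |1 / (symb k + m)| ^ 2 = 1 / (symb k + m) ^ 2
  rw [sq_abs, one_div_pow]

/-- `log m⁻¹ > 0` for `m ∈ (0,1)`. [folklore] -/
theorem log_inv_pos {m : ℝ} (hm : m ∈ Ioo (0:ℝ) 1) : 0 < Real.log m⁻¹ :=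
  Real.log_pos ((one_lt_inv₀ hm.1).2 hm.2)

/-- The lower comparison function `(log((π² + m)/m) + m/(π² + m) - 1)/log m⁻¹`. [folklore] -/
def lowerFn (m : ℝ) : ℝ :=
  (Real.log ((π ^ 2 + m) / m) + m / (π ^ 2 + m) - 1) / Real.log m⁻¹

/-- The upper comparison function for the radius `ρ` (`c = 1 - ρ²/12`):
`(c⁻²π²(log((ρ² + m/c)/(m/c)) + (m/c)/(ρ² + m/c) - 1) + (π²/ρ²)²(2π)⁴)/(π² log m⁻¹)`. [folklore] -/
def upperFn (ρ m : ℝ) : ℝ :=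
  ((1 - ρ ^ 2 / 12)⁻¹ ^ 2 * (π ^ 2 * (Real.log ((ρ ^ 2 + m / (1 - ρ ^ 2 / 12)) /
    (m / (1 - ρ ^ 2 / 12))) + (m / (1 - ρ ^ 2 / 12)) / (ρ ^ 2 + m / (1 - ρ ^ 2 / 12)) - 1)) +
    (π ^ 2 / ρ ^ 2) ^ 2 * (2 * π) ^ 4) / (π ^ 2 * Real.log m⁻¹)

/-- `lowerFn m ≤ J(m)/(π² log m⁻¹)` for `m ∈ (0,1)`. [folklore] -/
theorem lowerFn_le {m : ℝ} (hm : m ∈ Ioo (0:ℝ) 1) :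
    lowerFn m ≤ (∫ k in brillouin 4, 1 / (symb k + m) ^ 2) / (π ^ 2 * Real.log m⁻¹) := by
  have hL := log_inv_pos hm
  have h := bubbleIntegral_ge hm.1
  unfold lowerFn
  rw [div_le_div_iff₀ hL (by positivity)]
  nlinarith [h, hL]

/-- `J(m)/(π² log m⁻¹) ≤ upperFn ρ m` for `m ∈ (0,1)`, `ρ ∈ (0,1]`. [folklore] -/
theorem le_upperFn {m ρ : ℝ} (hm : m ∈ Ioo (0:ℝ) 1) (hρ : 0 < ρ) (hρ1 : ρ ≤ 1) :
    (∫ k in brillouin 4, 1 / (symb k + m) ^ 2) / (π ^ 2 * Real.log m⁻¹) ≤ upperFn ρ m := by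
  have hL := log_inv_pos hm
  unfold upperFn
  exact div_le_div_of_nonneg_right (bubbleIntegral_le hm.1 hρ hρ1) (by positivity)

/-- `log m⁻¹ → +∞` as `m ↓ 0`. [folklore] -/
theorem tendsto_log_inv_nhdsGT : Tendsto (fun m : ℝ => Real.log m⁻¹) (𝓝[>] 0) atTop :=
  Real.tendsto_log_atTop.comp tendsto_inv_nhdsGT_zero

/-- `lowerFn → 1` as `m ↓ 0`. [folklore] -/
theorem tendsto_lowerFn : Tendsto lowerFn (𝓝[>] 0) (𝓝 1) := by
  have hn : Tendsto (fun m : ℝ => Real.log (π ^ 2 + m) + m / (π ^ 2 + m) - 1) (𝓝[>] 0)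
      (𝓝 (Real.log (π ^ 2 + 0) + 0 / (π ^ 2 + 0) - 1)) := by
    refine tendsto_nhdsWithin_of_tendsto_nhds (ContinuousAt.tendsto ?_)
    have hp : (π : ℝ) ^ 2 + 0 ≠ 0 := by positivity
    fun_prop (disch := assumption)
  have h1 : Tendsto (fun m => 1 + (Real.log (π ^ 2 + m) + m / (π ^ 2 + m) - 1) / Real.log m⁻¹)
      (𝓝[>] 0) (𝓝 (1 + 0)) := tendsto_const_nhds.add (hn.div_atTop tendsto_log_inv_nhdsGT)
  rw [add_zero] at h1
  refine h1.congr' ?_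
  filter_upwards [Ioo_mem_nhdsGT zero_lt_one] with m hm
  have hL := log_inv_pos hm
  have hm0 : 0 < m := hm.1
  unfold lowerFn
  rw [Real.log_div (by positivity) hm0.ne', Real.log_inv] at *
  rw [add_div' _ _ _ hL.ne']
  congr 1
  ring

/-- `upperFn ρ → (1 - ρ²/12)⁻²` as `m ↓ 0`. [folklore] -/
theorem tendsto_upperFn {ρ : ℝ} (hρ : 0 < ρ) (hρ1 : ρ ≤ 1) :
    Tendsto (upperFn ρ) (𝓝[>] 0) (𝓝 ((1 - ρ ^ 2 / 12)⁻¹ ^ 2)) := by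
  set c : ℝ := 1 - ρ ^ 2 / 12 with hc
  have hcpos : 0 < c := by rw [hc]; nlinarith
  have hn : Tendsto (fun m : ℝ => Real.log (ρ ^ 2 + m / c) + (m / c) / (ρ ^ 2 + m / c) - 1 + Real.log c)
      (𝓝[>] 0) (𝓝 (Real.log (ρ ^ 2 + 0 / c) + (0 / c) / (ρ ^ 2 + 0 / c) - 1 + Real.log c)) := by
    refine tendsto_nhdsWithin_of_tendsto_nhds (ContinuousAt.tendsto ?_)
    have hp : ρ ^ 2 + 0 / c ≠ 0 := by positivity
    have hc0 : c ≠ 0 := hcpos.ne'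
    fun_prop (disch := assumption)
  have h1 : Tendsto (fun m => c⁻¹ ^ 2 + (c⁻¹ ^ 2 * (π ^ 2 *
      (Real.log (ρ ^ 2 + m / c) + (m / c) / (ρ ^ 2 + m / c) - 1 + Real.log c)) +
      (π ^ 2 / ρ ^ 2) ^ 2 * (2 * π) ^ 4) / (π ^ 2 * Real.log m⁻¹)) (𝓝[>] 0) (𝓝 (c⁻¹ ^ 2 + 0)) :=
    tendsto_const_nhds.add (((tendsto_const_nhds.mul (tendsto_const_nhds.mul hn)).add
      tendsto_const_nhds).div_atTop (tendsto_log_inv_nhdsGT.const_mul_atTop (by positivity)))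
  rw [add_zero] at h1
  refine h1.congr' ?_
  filter_upwards [Ioo_mem_nhdsGT zero_lt_one] with m hm
  have hL := log_inv_pos hm
  have hm0 : 0 < m := hm.1
  unfold upperFn
  rw [← hc]
  have hlog : Real.log ((ρ ^ 2 + m / c) / (m / c)) =
      Real.log (ρ ^ 2 + m / c) + Real.log m⁻¹ + Real.log c := by
    rw [Real.log_div (by positivity) (by positivity), Real.log_div hm0.ne' hcpos.ne',
      Real.log_inv]
    ring
  rw [hlog, add_div' _ _ _ (by positivity : π ^ 2 * Real.log m⁻¹ ≠ 0)]
  congr 1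
  ring

/-- **(1.8) at `d = 4` holds**: `𝖡_{m²}/(𝖻 log m⁻²) → 1` as `m² ↓ 0`, `𝖻 = 1/(2π²)`
(Bauerschmidt–Brydges–Slade 2015, (1.8), "by Parseval's formula and elementary calculus"; here
from the two-sided bound `lowerFn ≤ J/(π² log m⁻²) ≤ upperFn ρ` and `ρ ↓ 0`).
[cite: BauerschmidtBrydgesSlade2015LogCorr, eq. (1.8)] -/
theorem BBS2015_eq18_holds : BBS2015_eq18 := by
  unfold BBS2015_eq18
  have hratio : ∀ᶠ m in 𝓝[>] (0:ℝ), freeBubble 4 m / (freeBubbleB * Real.log m⁻¹) =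
      (∫ k in brillouin 4, 1 / (symb k + m) ^ 2) / (π ^ 2 * Real.log m⁻¹) := by
    filter_upwards [Ioo_mem_nhdsGT zero_lt_one] with m hm
    have hL := log_inv_pos hm
    rw [freeBubble_four_eq, freeBubbleB]
    field_simp
    ring
  rw [Metric.tendsto_nhds]
  intro ε hε
  set ε' : ℝ := min ε 1 with hε'
  have hε'pos : 0 < ε' := lt_min hε zero_lt_one
  have hε'1 : ε' ≤ 1 := min_le_right _ _
  have hε'ε : ε' ≤ ε := min_le_left _ _
  set ρ : ℝ := Real.sqrt ε' with hρ
  have hρpos : 0 < ρ := Real.sqrt_pos.2 hε'pos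
  have hρsq : ρ ^ 2 = ε' := Real.sq_sqrt hε'pos.le
  have hρ1 : ρ ≤ 1 := by
    rw [hρ]
    exact (Real.sqrt_le_sqrt hε'1).trans_eq Real.sqrt_one
  have hcpos : 0 < 1 - ρ ^ 2 / 12 := by nlinarith
  have hclt : (1 - ρ ^ 2 / 12)⁻¹ ^ 2 < 1 + ε := by
    have key : 1 < (1 + ε) * (1 - ρ ^ 2 / 12) ^ 2 := by
      rw [hρsq]
      nlinarith [mul_pos hε'pos hε'pos, mul_nonneg hε'pos.le (sub_nonneg.2 hε'ε)]
    rw [inv_pow, inv_lt_iff_one_lt_mul₀ (pow_pos hcpos 2)]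
    linarith [key]
  have hev_lo : ∀ᶠ m in 𝓝[>] (0:ℝ), 1 - ε < lowerFn m :=
    tendsto_lowerFn.eventually (lt_mem_nhds (by linarith))
  have hev_up : ∀ᶠ m in 𝓝[>] (0:ℝ), upperFn ρ m < 1 + ε :=
    (tendsto_upperFn hρpos hρ1).eventually (gt_mem_nhds hclt)
  filter_upwards [hratio, hev_lo, hev_up, Ioo_mem_nhdsGT zero_lt_one] with m hr hlo hup hm
  rw [hr, Real.dist_eq, abs_lt]
  have h1 := lowerFn_le hm
  have h2 := le_upperFn hm hρpos hρ1
  constructor <;> linarith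

end CTWSAW

end Literature.Barriers.CriticalPhenomena
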